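import Summits.PneNP.PneNP.Theses.Descriptive
import Literature.ModelTheory.FiniteModelTheory.POptimalAndLogicsForPTIMEChenFlumProofs

/-!
# Route Descriptive — support `FaginBridge` (stmt-PneNP-9099)

`DescriptiveThesis → PneNP`: Gurevich's conjecture (no logic captures PTIME on graphs, for every
clocked universal machine) implies `P ≠ NP`. Composition of Chen–Flum 2010, Cor. 10 contraposed
(thesis ⇒ no p-optimal proof system for `TAUT`; proved fact
`ChenFlum2010_logicForP_of_pOptimalTaut_holds`) with the route's deciding theorem
`Descriptive.closes : NoPOptimalTaut → PneNP` (if `P = NP` the polynomial-time `TAUT` decider is a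
p-optimal proof system).
-/

set_option linter.dupNamespace false -- `Summit.PneNP.PneNP.…`: summit = sub-problem name (D-0017 single-conjunct layout)

namespace Summit.PneNP.PneNP.Theorems

open Literature.ModelTheory.FiniteModelTheory

/-- **Support item `FaginBridge` (stmt-PneNP-9099)**: `DescriptiveThesis → PneNP` — Chen–Flum
2010 Cor. 10 contraposed (`no_pOptimalTaut_of_noLogicForP` over the proved fact
`ChenFlum2010_logicForP_of_pOptimalTaut_holds`), then `Descriptive.closes`.
[Chen–Flum 2010, Cor. 10; Krajíček–Pudlák 1989, §1] -/
theorem descriptive_faginBridge_proof :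
    Summit.PneNP.PneNP.Theses.Descriptive.FaginBridge := by
  unfold Summit.PneNP.PneNP.Theses.Descriptive.FaginBridge
    Summit.PneNP.PneNP.Theses.Descriptive.DescriptiveThesis
  exact fun hX => Summit.PneNP.PneNP.Theses.Descriptive.closes
    (ChenFlum2010_logicForP_of_pOptimalTaut.no_pOptimalTaut_of_noLogicForP
      ChenFlum2010_logicForP_of_pOptimalTaut_holds hX)

end Summit.PneNP.PneNP.Theorems
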